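import Summits.CriticalPhenomena.SAWScalingLimit.Theorems.SAWDevelopingMapHexConjectureKPDefs
import HarnessLib

/-!
# Crux `HexConjecture` (stmt-CriticalPhenomena-0808), line `root-locality-replaces-loewner`:
Krachun–Panagiotis, construction (a) — gluing a right exit of `T_k` with a cut exit of the
attached clipped triangle

Landing target:
`Summits/CriticalPhenomena/SAWScalingLimit/Theorems/SAWDevelopingMapHexConjectureKPGlueA.lean`
(`--supports stmt-CriticalPhenomena-0808`; registered stub `stub_kp_glueA`).

Krachun–Panagiotis (arXiv:2310.17299, §3.2, construction (a), Fig. 4): a walk `γ₁` of the triangle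
`Tria_{2k+1} = T_k = HV.triV k` from the root mid-edge `a` to its right side, exiting at the cell
`x = (x₀, x₁)` (`x₀ + x₁ = k`), is continued by a walk `γ₂` of the trapezoid `Trap_{2i+1,x}` from `x` to
the real axis; the concatenation is a self-avoiding arch of the upper half-plane from `a` to the
boundary.  In the coordinate model `HV` of the tree: `P₁ ∈ rightWalks k` with final dart
`((x₀,x₁,false), (x₀,x₁,true))`, `P₂` a mid-walk of the clipped triangle `clipV i x₁` (standard frame)
leaving through the cut (`IsClipDart x₁`), placed by the attachment automorphism `attach x₀ x₁`
(`(y₀, y₁, b) ↦ (x₀ + y₀ + y₁ + b, x₁ - y₀, ¬b)`), which sends the standard root dart `(w, O)` onto the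
exit dart of `P₁`.  The glued list `P₁ ++ (P₂.map (attach x₀ x₁)).drop 2` is a mid-walk of the
Duminil-Copin–Smirnov trapezoid `S_{N+1,N+1}` (`2k + i ≤ N`) exiting through the floor (class `α`) at
offset `k + 1 + y₁`, where `y₁ ∈ [0, i)` is the standard level of the cut exit of `P₂`; lengths add; the
attached part lives at slanted levels `slev ≥ k + 1` (the first piece at `slev ≤ k`), which is the
self-avoidance of the concatenation.  The bookkeeping imitates `HV.GlueData` (Glazman–Manolescu's
three-piece gluing, `HexSAWBridgeDecay.lean`).
Sources: KrachunPanagiotis2026 (§3.2), GlazmanManolescu2019 (§4.1), DuminilCopinSmirnov2012 (§3).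
-/

noncomputable section

open Finset
open Literature.Probability.RandomPlanarGeometry.SAW Literature.Probability.RandomPlanarGeometry.SAW.HV

namespace Summit.CriticalPhenomena.SAWScalingLimit.Theorems.HexConjecture.RootLocality

/-! ### Anatomy of the two pieces -/

/-- **Anatomy of the first piece**: a walk of `T_k` to its right side exiting through the dart
`((x₀,x₁,false), (x₀,x₁,true))` is `w, O, …, (x₀,x₁,false), (x₀,x₁,true)` with `x₀ + x₁ = k`,
`0 ≤ x₁`, `-k ≤ x₀`. [cite: KrachunPanagiotis2026, §3.2 (x ∈ R_{2k+1})] -/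
theorem glueA_anatomy₁ {k : ℕ} {P : List HV} {x₀ x₁ : ℤ} (hP : P ∈ rightWalks k)
    (hfd : finalDart P = ((x₀, x₁, false), (x₀, x₁, true))) :
    ∃ (l : List HV) (hl : l ≠ []), P = wOut :: (l ++ [(x₀, x₁, true)]) ∧
      l.getLast hl = (x₀, x₁, false) ∧ IsMidWalk (triV k) P ∧ x₀ + x₁ = k ∧ 0 ≤ x₁ ∧
        -(k : ℤ) ≤ x₀ := by
  rw [rightWalks, mem_filter, mem_midWalks_iff] at hP
  obtain ⟨hW, hR⟩ := hP
  rw [hfd] at hR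
  have hk : x₀ + x₁ = k := hR.1
  rcases hW.trivial_or_exists with rfl | ⟨l, u, hl, rfl⟩
  · rw [finalDart_trivial] at hfd
    simp [wOut] at hfd
  rw [finalDart_cons_append hl u, Prod.mk.injEq] at hfd
  obtain ⟨h1, rfl⟩ := hfd
  obtain ⟨-, -, -, hlV, -, -⟩ := (isMidWalk_cons_append_iff _ hl _).1 hW
  have hv := mem_triV_iff.1 (hlV _ (List.getLast_mem hl))
  rw [h1] at hv
  exact ⟨l, hl, rfl, h1, hW, hk, hv.1, hv.2.1⟩

/-- **Anatomy of the second piece**: a walk of the clipped triangle `C(i,h)` leaving through the cut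
is `w, O, …, (h, y, true), (h+1, y, false)` with `0 ≤ y` and `y + 1 + h ≤ i`.
[cite: KrachunPanagiotis2026, §3.2 (Trap_{2i+1,x}, F^B)] -/
theorem glueA_anatomy₂ {i h : ℕ} {P : List HV} (hP : P ∈ midWalks (clipV i h))
    (hc : IsClipDart h (finalDart P)) :
    ∃ (y : ℤ) (l : List HV) (hl : l ≠ []), P = wOut :: (l ++ [((h : ℤ) + 1, y, false)]) ∧
      l.getLast hl = ((h : ℤ), y, true) ∧ IsMidWalk (clipV i h) P ∧ 0 ≤ y ∧ y + 1 + h ≤ i := by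
  rw [mem_midWalks_iff] at hP
  rcases hP.trivial_or_exists with rfl | ⟨l, u, hl, rfl⟩
  · rw [finalDart_trivial] at hc
    have := hc.2.2
    simp [hvOrigin, wOut] at this
  rw [finalDart_cons_append hl u] at hc
  obtain ⟨hc1, hc2, hc3⟩ := hc
  dsimp only at hc1 hc2 hc3
  obtain ⟨-, -, -, hlV, -, -⟩ := (isMidWalk_cons_append_iff _ hl _).1 hP
  have hv := mem_clipV_iff.1 (hlV _ (List.getLast_mem hl))
  have hb : bit (l.getLast hl) = 1 := by simp [bit, hc2]
  refine ⟨(l.getLast hl).2.1, l, hl, ?_, Prod.ext hc1 (Prod.ext rfl hc2), hP, hv.1, ?_⟩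
  · rw [hc3, hc1]
  · omega

/-! ### The attached piece: where it lives -/

/-- **The attached clipped triangle lies in the strip, beyond the line `slev = k ∣ k+1`, in the
upper half-plane**: for `v ∈ C(i,h)` and the attachment at the right dart of the cell `(x₀, h)` of
`T_k` (`x₀ + h = k`, `-k ≤ x₀`), `attach x₀ h v ∈ S_{N+1,N+1}` once `2k + i ≤ N`, its slanted level is
`≥ k + 1` and its height is `≥ 0`. [cite: KrachunPanagiotis2026, §3.2 (Trap_{2i+1,x} ⊂ 𝕌)] -/
theorem glueA_attach_region {k i N h : ℕ} {x₀ : ℤ} (hk : x₀ + h = k) (hx₀ : -(k : ℤ) ≤ x₀)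
    (hN : 2 * k + i + 1 ≤ N + 1) {v : HV} (hv : v ∈ clipV i h) :
    attach x₀ h v ∈ stripV (N + 1) (N + 1) ∧ (k : ℤ) + 1 ≤ slev (attach x₀ h v) ∧
      0 ≤ (attach x₀ h v).2.1 := by
  rw [mem_clipV_iff] at hv
  rw [mem_stripV_iff]
  obtain ⟨a, b, c⟩ := v
  cases c <;> simp [bit, lev] at hv ⊢ <;> omega

/-- The placed cut exit: the last inner vertex `(h, y, true)` of the second piece goes to the floor
cell `(k + 1 + y, 0, false)`. [cite: KrachunPanagiotis2026, §3.2 (Fig. 4)] -/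
theorem glueA_attach_last {k h : ℕ} {x₀ : ℤ} (hk : x₀ + h = k) (y : ℤ) :
    attach x₀ h ((h : ℤ), y, true) = ((k : ℤ) + 1 + y, 0, false) := by
  rw [attach_apply, Prod.mk.injEq, Prod.mk.injEq]
  refine ⟨?_, ?_, rfl⟩ <;> dsimp only [bit_true] <;> omega

/-- The placed cut exit: the outer vertex `(h+1, y, false)` of the second piece goes below the
boundary line, to `(k + 1 + y, -1, true)`. [cite: KrachunPanagiotis2026, §3.2 (Fig. 4)] -/
theorem glueA_attach_end {k h : ℕ} {x₀ : ℤ} (hk : x₀ + h = k) (y : ℤ) :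
    attach x₀ h ((h : ℤ) + 1, y, false) = ((k : ℤ) + 1 + y, -1, true) := by
  rw [attach_apply, Prod.mk.injEq, Prod.mk.injEq]
  refine ⟨?_, ?_, rfl⟩ <;> dsimp only [bit_false] <;> omega

/-! ### The glued list -/

/-- **The glued list, unfolded**: since `P₁` ends with `…, attach w, attach O` and
`P₂.map attach` starts with `attach w, attach O, …`, dropping the first two entries of the latter
concatenates the inner lists:
`P₁ ++ (P₂.map attach).drop 2 = w :: ((l₁ ++ l₂.map attach) ++ [attach u₂])`.
[cite: KrachunPanagiotis2026, §3.2 (construction (a))] -/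
theorem glueA_eq {x₀ x₁ : ℤ} {l₁ l₂ : List HV} (hd₂ : l₂.head? = some hvOrigin) (u₂ : HV) :
    wOut :: (l₁ ++ [(x₀, x₁, true)]) ++ ((wOut :: (l₂ ++ [u₂])).map (attach x₀ x₁)).drop 2 =
      wOut :: ((l₁ ++ l₂.map (attach x₀ x₁)) ++ [attach x₀ x₁ u₂]) := by
  obtain ⟨t, rfl⟩ : ∃ t, l₂ = hvOrigin :: t := ⟨l₂.tail, GlueData.eq_cons_of_head hd₂⟩
  simp [-attach_apply]

/-- The tail of the placed second piece (what is appended to `P₁`) consists of placed vertices of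
`l₂ ++ [u₂]`. [folklore] -/
theorem glueA_mem_drop {φ : HV → HV} {l₂ : List HV} {u₂ v : HV}
    (hv : v ∈ ((wOut :: (l₂ ++ [u₂])).map φ).drop 2) : v ∈ (l₂ ++ [u₂]).map φ := by
  rw [List.map_cons, List.drop_succ_cons] at hv
  exact List.drop_subset _ _ hv

/-! ### Construction (a) -/

/-- **Registered sub-goal `stub_kp_glueA`** (crux item stmt-CriticalPhenomena-0808, line
`root-locality-replaces-loewner`) — **Krachun–Panagiotis, construction (a)**: glue a walk `P₁` of
`T_k` exiting through the right dart of the cell `(x₀, x₁)` with a walk `P₂` of the clipped triangle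
`C(i, x₁)` leaving through its cut, placed by `attach x₀ x₁`.  The glued list
`P₁ ++ (P₂.map (attach x₀ x₁)).drop 2` is a self-avoiding mid-edge walk of the strip `S_{N+1,N+1}`
(`2k + i ≤ N`) whose final half-edge is the floor half-edge at offset `k + 1 + y₁`
(`y₁ = (finalDart P₂).1.2.1 ∈ [0, i)`), its length is `ℓ(P₁) + ℓ(P₂)`, and the attached part lies at
slanted levels `≥ k + 1`. [cite: KrachunPanagiotis2026, §3.2 (construction (a), Fig. 4)] -/
theorem stub_kp_glueA : ∀ (k i N : ℕ) (P₁ P₂ : List Literature.Probability.RandomPlanarGeometry.SAW.HV) (x₀ x₁ : ℤ), P₁ ∈ rightWalks k → Literature.Probability.RandomPlanarGeometry.SAW.HV.finalDart P₁ = ((x₀, x₁, false), (x₀, x₁, true)) → P₂ ∈ Literature.Probability.RandomPlanarGeometry.SAW.HV.midWalks (clipV i x₁.toNat) → IsClipDart x₁.toNat (Literature.Probability.RandomPlanarGeometry.SAW.HV.finalDart P₂) → 2 * k + i + 1 ≤ N + 1 → (P₁ ++ (P₂.map (attach x₀ x₁)).drop 2) ∈ Literature.Probability.RandomPlanarGeometry.SAW.HV.midWalks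 (Literature.Probability.RandomPlanarGeometry.SAW.HV.stripV (N + 1) (N + 1)) ∧ Literature.Probability.RandomPlanarGeometry.SAW.HV.finalDart (P₁ ++ (P₂.map (attach x₀ x₁)).drop 2) = ((k + 1 + (Literature.Probability.RandomPlanarGeometry.SAW.HV.finalDart P₂).1.2.1, 0, false), (k + 1 + (Literature.Probability.RandomPlanarGeometry.SAW.HV.finalDart P₂).1.2.1, -1, true)) ∧ Literature.Probability.RandomPlanarGeometry.SAW.HV.mwLen (P₁ ++ (P₂.map (attach x₀ x₁)).drop 2) = Literature.Probability.RandomPlanarGeometry.SAW.HV.mwLen P₁ + Literature.Probability.RandomPlanarGeometry.SAW.HV.mwLen P₂ ∧ (∀ v ∈ (P₂.map (attach x₀ x₁)).drop 2, (k : ℤ) + 1 ≤ slev v) ∧ 0 ≤ (Literature.Probability.RandomPlanarGeometry.SAW.HV.finalDart P₂).1.2.1 ∧ (Literature.Probability.RandomPlanarGeometry.SAW.HV.finalDart P₂).1.2.1 + 1 ≤ i := by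
  intro k i N P₁ P₂ x₀ x₁ hP₁ hfd₁ hP₂ hc₂ hN
  obtain ⟨l₁, h₁, e₁, -, w₁, hk, hx₁, hx₀⟩ := glueA_anatomy₁ hP₁ hfd₁
  obtain ⟨h, rfl⟩ := Int.eq_ofNat_of_zero_le hx₁
  rw [Int.toNat_natCast] at hP₂ hc₂
  obtain ⟨y, l₂, h₂, e₂, last₂, w₂, hy0, hyi⟩ := glueA_anatomy₂ hP₂ hc₂
  have hfdy : (finalDart P₂).1.2.1 = y := by
    rw [e₂, finalDart_cons_append h₂, last₂]
  rw [hfdy]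
  subst e₁ e₂
  obtain ⟨c₁, hd₁, a₁, V₁, n₁, -⟩ := (isMidWalk_cons_append_iff _ h₁ _).1 w₁
  obtain ⟨c₂, hd₂, a₂, V₂, n₂, -⟩ := (isMidWalk_cons_append_iff _ h₂ _).1 w₂
  -- the inner list of the glued walk is `l₁ ++ l₂.map (attach x₀ h)`
  have hmap : l₂.map (attach x₀ h) ≠ [] := by simp [h₂]
  have hM : l₁ ++ l₂.map (attach x₀ h) ≠ [] := List.append_ne_nil_of_left_ne_nil h₁ _
  have hMlast : (l₁ ++ l₂.map (attach x₀ h)).getLast hM = attach x₀ h (l₂.getLast h₂) := by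
    rw [List.getLast_append_of_ne_nil hM hmap, List.getLast_map]
  have hreg : ∀ v ∈ l₂, attach x₀ h v ∈ stripV (N + 1) (N + 1) ∧
      (k : ℤ) + 1 ≤ slev (attach x₀ h v) ∧ 0 ≤ (attach x₀ h v).2.1 :=
    fun v hv => glueA_attach_region hk hx₀ hN (V₂ v hv)
  have hsub₁ : triV k ⊆ stripV (N + 1) (N + 1) := triV_subset_stripV (by omega) (by omega)
  have hMV : ∀ x ∈ l₁ ++ l₂.map (attach x₀ h), x ∈ stripV (N + 1) (N + 1) := by
    intro x hx
    rcases List.mem_append.1 hx with hx | hx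
    · exact hsub₁ (V₁ x hx)
    · obtain ⟨v, hv, rfl⟩ := List.mem_map.1 hx
      exact (hreg v hv).1
  have hMup : ∀ x ∈ l₁ ++ l₂.map (attach x₀ h), 0 ≤ x.2.1 := fun x hx =>
    (mem_stripV_iff.1 (hMV x hx)).1
  rw [glueA_eq hd₂]
  refine ⟨?_, ?_, ?_, ?_, hy0, by omega⟩
  · -- the glued list is a self-avoiding mid-edge walk of the strip
    rw [mem_midWalks_iff, isMidWalk_cons_append_iff _ hM]
    refine ⟨?_, ?_, ?_, hMV, ?_, ?_⟩
    · -- a lattice path: `attach` is an automorphism sending `O` to the exit vertex of `P₁`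
      have c₂' : (l₂.map (attach x₀ h)).IsChain hvGraph.Adj := by
        rw [List.isChain_map]
        exact c₂.imp fun a b hab => (attach x₀ h).map_rel_iff.2 hab
      refine List.IsChain.append c₁ c₂' fun a ha b hb => ?_
      rw [List.getLast?_eq_some_getLast h₁, Option.mem_def, Option.some_inj] at ha
      rw [List.head?_map, hd₂, Option.map_some, Option.mem_def, Option.some_inj] at hb
      subst ha; subst hb
      rw [attach_hvOrigin]
      exact a₁
    · rw [List.head?_append, hd₁]; rfl
    · rw [hMlast]
      exact (attach x₀ h).map_rel_iff.2 a₂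
    · -- self-avoiding: the two pieces are separated by the line `slev = k ∣ k+1`
      refine List.Nodup.append n₁ (n₂.map (attach x₀ h).injective) ?_
      intro x hx1 hx2
      obtain ⟨v, hv, rfl⟩ := List.mem_map.1 hx2
      have s₁ : slev (attach x₀ h v) ≤ k := (mem_triV_iff.1 (V₁ _ hx1)).2.2
      have s₂ := (hreg v hv).2.1
      omega
    · -- non-retracing at the end: the exit vertex lies below the boundary line, not at `w`
      rw [glueA_attach_end hk]
      intro hEq
      rcases prevOf_mem (l₁ ++ l₂.map (attach x₀ h)) with h' | h'
      · rw [h'] at hEq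
        have := congrArg Prod.fst hEq
        simp [wOut] at this
        omega
      · rw [← hEq] at h'
        have := hMup _ h'
        simp at this
  · -- the final half-edge: the floor half-edge at offset `k + 1 + y`
    rw [finalDart_cons_append hM, hMlast, last₂, glueA_attach_last hk, glueA_attach_end hk]
  · -- lengths add
    simp only [mwLen_cons_append, List.length_append, List.length_map]
  · -- the attached part lies beyond the line `slev = k ∣ k+1`
    intro v hv
    obtain ⟨u, hu, rfl⟩ := List.mem_map.1 (glueA_mem_drop hv)
    rcases List.mem_append.1 hu with hu | hu
    · exact (hreg u hu).2.1
    · rw [List.mem_singleton] at hu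
      subst hu
      rw [glueA_attach_end hk, slev_mk, bit_true]
      omega

end Summit.CriticalPhenomena.SAWScalingLimit.Theorems.HexConjecture.RootLocality

end
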